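import Literature.NumberTheory.Transcendental.CurvePeriodsEllipticFormsProofs
import Mathlib.Analysis.SpecialFunctions.Sqrt
import Mathlib.Analysis.SpecialFunctions.Pow.Deriv

/-!
# `RealOnePeriodRelations` (stmt-KontsevichZagierPeriods-10042), line `nash-retraction-thin-strip`
# (elliptic layer): stub `stub_ellIntegrand` — the chain rule along the cubic reparametrisation

On the affine Weierstrass curve `E_{A,B} : y² = f(x) = x³ + Ax + B` (`weierCurve A B`, real
`A, B`) consider the path `γ(t) = (x(t), √f(x(t)))` with `x(t) = a + (b − a)(3t² − 2t³)` and a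
polynomial 1-form `ω = G dx + H dy`. At an interior time `t ∈ (0,1)` with `g(t) := f(x(t)) > 0`
both coordinates are differentiable, `x′(t) = (b − a)(6t − 6t²)` and
`(√g)′(t) = g′(t) / (2√g(t)) = (3x(t)² + A) x′(t) / (2√g(t))`, so the integrand of the period
`∫_γ ω` at `t` is

  `G(γ(t)) x′(t) + H(γ(t)) (√g)′(t) = (G(γ(t)) + H(γ(t)) · (3x(t)² + A)/(2√g(t))) · x′(t)`.

Only the formula for `γ.toFun` is used (not the `CurvePath` fields). Mathlib calculus only:
`HasDerivAt.sqrt`, `HasDerivAt.ofReal_comp`, polynomial derivatives.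
-/

noncomputable section

open scoped BigOperators
open Set MvPolynomial
open Literature.NumberTheory.Transcendental Literature.NumberTheory.Transcendental.CurvePeriods

namespace Summit.KontsevichZagierPeriods.SymplecticScissors.RealOnePeriodRelations.EllipticLayer

/-- The derivative of the cubic reparametrisation `x(u) = a + (b − a)(3u² − 2u³)` is
`x′(t) = (b − a)(6t − 6t²)`. [folklore] -/
private theorem hasDerivAt_cubicParam (a b t : ℝ) :
    HasDerivAt (fun u : ℝ => a + (b - a) * (3 * u ^ 2 - 2 * u ^ 3))
      ((b - a) * (6 * t - 6 * t ^ 2)) t := by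
  have h := ((((hasDerivAt_pow 2 t).const_mul 3).sub ((hasDerivAt_pow 3 t).const_mul 2)).const_mul
    (b - a)).const_add a
  refine h.congr_deriv ?_
  simp only [Nat.cast_ofNat]
  ring

/-- The derivative of `g(u) = f(x(u)) = x(u)³ + A x(u) + B` along the cubic reparametrisation is
`g′(t) = (3x(t)² + A) · x′(t)`. [folklore] -/
private theorem hasDerivAt_cubicParam_f (A B a b t : ℝ) :
    HasDerivAt (fun u : ℝ => (a + (b - a) * (3 * u ^ 2 - 2 * u ^ 3)) ^ 3 +
        A * (a + (b - a) * (3 * u ^ 2 - 2 * u ^ 3)) + B)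
      ((3 * (a + (b - a) * (3 * t ^ 2 - 2 * t ^ 3)) ^ 2 + A) * ((b - a) * (6 * t - 6 * t ^ 2))) t := by
  have hx := hasDerivAt_cubicParam a b t
  have h := ((hx.pow 3).add (hx.const_mul A)).add_const B
  refine h.congr_deriv ?_
  simp only [Nat.cast_ofNat]
  ring

/-- The derivative of `√g(u)`, `g = f ∘ x` as above, at a time `t` with `g(t) > 0`:
`(√g)′(t) = (3x(t)² + A) x′(t) / (2√g(t))`. [folklore] -/
private theorem hasDerivAt_sqrt_cubicParam_f (A B a b t : ℝ)
    (hpos : 0 < (a + (b - a) * (3 * t ^ 2 - 2 * t ^ 3)) ^ 3 +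
        A * (a + (b - a) * (3 * t ^ 2 - 2 * t ^ 3)) + B) :
    HasDerivAt (fun u : ℝ => Real.sqrt ((a + (b - a) * (3 * u ^ 2 - 2 * u ^ 3)) ^ 3 +
        A * (a + (b - a) * (3 * u ^ 2 - 2 * u ^ 3)) + B))
      ((3 * (a + (b - a) * (3 * t ^ 2 - 2 * t ^ 3)) ^ 2 + A) * ((b - a) * (6 * t - 6 * t ^ 2)) /
        (2 * Real.sqrt ((a + (b - a) * (3 * t ^ 2 - 2 * t ^ 3)) ^ 3 +
          A * (a + (b - a) * (3 * t ^ 2 - 2 * t ^ 3)) + B))) t :=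
  (hasDerivAt_cubicParam_f A B a b t).sqrt hpos.ne'

/-- **The chain rule along the path.** On `(0,1)`, where `f(x(t)) > 0`, the integrand of the period
of `(E_{A,B}, G dx + H dy, γ)` with `γ(t) = (x(t), √f(x(t)))`, `x(t) = a + (b − a)(3t² − 2t³)`, is
`Σᵢ ωᵢ(γ(t)) γᵢ′(t) = (G(γ(t)) + H(γ(t)) f′(x(t))/(2√f(x(t)))) · x′(t)`. [folklore] -/
theorem stub_ellIntegrand : ∀ (A B a b : ℝ) (γ : CurvePath (weierCurve (A : ℂ) (B : ℂ)))
    (G H : MvPolynomial (Fin 2) ℂ),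
    (∀ t : ℝ, γ.toFun t = ![(((a + (b - a) * (3 * t ^ 2 - 2 * t ^ 3)) : ℝ) : ℂ),
        ((Real.sqrt ((a + (b - a) * (3 * t ^ 2 - 2 * t ^ 3)) ^ 3 + A * (a + (b - a) * (3 * t ^ 2 - 2 * t ^ 3)) + B) : ℝ) : ℂ)]) →
    ∀ t ∈ Set.Ioo (0 : ℝ) 1, 0 < (a + (b - a) * (3 * t ^ 2 - 2 * t ^ 3)) ^ 3 + A * (a + (b - a) * (3 * t ^ 2 - 2 * t ^ 3)) + B →
      (∑ i, MvPolynomial.eval (γ.toFun t) ((![G, H] : Fin 2 → MvPolynomial (Fin 2) ℂ) i) *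
          deriv (fun u => γ.toFun u i) t) =
        (MvPolynomial.eval (γ.toFun t) G + MvPolynomial.eval (γ.toFun t) H *
          (((3 * (a + (b - a) * (3 * t ^ 2 - 2 * t ^ 3)) ^ 2 + A) /
            (2 * Real.sqrt ((a + (b - a) * (3 * t ^ 2 - 2 * t ^ 3)) ^ 3 + A * (a + (b - a) * (3 * t ^ 2 - 2 * t ^ 3)) + B)) : ℝ) : ℂ)) *
          (((b - a) * (6 * t - 6 * t ^ 2) : ℝ) : ℂ) := by
  intro A B a b γ G H hγ t _ht hpos
  -- the two coordinate functions of `γ` and their derivatives at `t`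
  have h0 : deriv (fun u => γ.toFun u 0) t = (((b - a) * (6 * t - 6 * t ^ 2) : ℝ) : ℂ) := by
    have hfun : (fun u => γ.toFun u 0) =
        fun u : ℝ => (((a + (b - a) * (3 * u ^ 2 - 2 * u ^ 3)) : ℝ) : ℂ) := by
      funext u
      rw [hγ u]
      rfl
    rw [hfun]
    exact (hasDerivAt_cubicParam a b t).ofReal_comp.deriv
  have h1 : deriv (fun u => γ.toFun u 1) t =
      (((3 * (a + (b - a) * (3 * t ^ 2 - 2 * t ^ 3)) ^ 2 + A) * ((b - a) * (6 * t - 6 * t ^ 2)) /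
        (2 * Real.sqrt ((a + (b - a) * (3 * t ^ 2 - 2 * t ^ 3)) ^ 3 +
          A * (a + (b - a) * (3 * t ^ 2 - 2 * t ^ 3)) + B)) : ℝ) : ℂ) := by
    have hfun : (fun u => γ.toFun u 1) =
        fun u : ℝ => ((Real.sqrt ((a + (b - a) * (3 * u ^ 2 - 2 * u ^ 3)) ^ 3 +
          A * (a + (b - a) * (3 * u ^ 2 - 2 * u ^ 3)) + B) : ℝ) : ℂ) := by
      funext u
      rw [hγ u]
      rfl
    rw [hfun]
    exact (hasDerivAt_sqrt_cubicParam_f A B a b t hpos).ofReal_comp.deriv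
  rw [Fin.sum_univ_two, h0, h1]
  simp only [Matrix.cons_val_zero, Matrix.cons_val_one]
  push_cast
  ring

end Summit.KontsevichZagierPeriods.SymplecticScissors.RealOnePeriodRelations.EllipticLayer

end
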